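import Summits.QuantumFields.BalabanUV.Beta.GAN24.CapacitanceCancellationDefect

/-!
# `BalabanUV.Beta.GAN24.PinnedScalarBounds` — binder row G-an2-4 / (CONV-C), road P1-fibre, strip step L10 — the (M2)/(M3) «regularised closed form» ENGINE,
# REAL-ZONE HALF, part 1: `N`-UNIFORM TWO-SIDED BOUNDS for the REGULARISED scalars `ã_κ`, `σ̃` of the PINNED zero-alias block on ALL of the
# Brillouin zone — `q = 0` INCLUDED (part 2 = `GAN24/PinnedScalarOmega`: the denominator `Ω`, the dictionary with Y08s, strip-transfer shapes)

NOT IN PRINT; OUR PROOF ATTEMPT.  HONEST FRAMING (cell contract, verbatim): «discharging `BetaPertH` makes Bałaban's UV stability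
UNCONDITIONAL — a real constructive-QFT result; it is NOT the continuum limit and NOT the Clay problem.»  HONEST DEPENDENCY (verbatim):
«continuum YM on T⁴ ⇐ BetaPertH ∧ nine spine estimates (0/9 proved); BetaPertH ⇐ (D1) ∧ (D4) ∧ CAP+tail; G-an2-4 gates asym, D1 and
NE2/3/4.»  [folklore] explicit elementary analysis (King 1986 Lemma 4.1 pattern) in the real currency of leaves P1-L06 / P1-Y08s; it
discharges NOTHING of (CONV-C)'s K-slot `GAN24.CombesThomas.ConvCK 3 Lc` by itself.  NOT `BetaPertH`, NOT continuum, NOT Clay.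
No `def … : Prop`, no cited fact, no wall binder; the `def`s below are explicit real functions / explicit constants.
STATUS IN THE CELL (honest): a BANKED ENGINE for the ALTERNATIVE road (M2)/(M3) to L10(ii) («regularised closed form», leaf-02-g5's
`CapacitanceClosedFormEnlarged` = Y10e*), written in typer LEAVES.md v2.7's Y10zi window; under the L10 OWNER's cut (M4) (leaf-16-g6
`L10-CUT-M4.md`, ratified by gan24-p1-g2 as SKELETON-P1 A5 v0.3) the pinned block is handled in OPERATOR norm (rows F3/F4) and THIS FILE IS
OFF THE CRITICAL PATH of (I3′) — it makes the banked closed form EFFECTIVE on the whole real zone, nothing more.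

## The objects (gan24-p1 DESIGNER'S RULING on L10, journal l.3079; leaf-02-g5's `CapacitanceClosedFormEnlarged`)
The closed form of the zero-alias-ENLARGED («pinned») block (`CapacitanceClosedFormEnlarged.enlBordered_iff_closedForm`) has as its ONLY
denominators the REGULARISED scalars `ã_κ = wQ0_κ wE0_κ/2 + L₀·a′_κ` (`aReg`), `σ̃ = wM0 wG0 + L₀²·σ′` (`sReg`),
`Ω = 1 − Σ_κ ∂♭₀_κ∂₀_κ a′_κ/ã_κ` (`Omega`) and the zero-alias weights — NO `1/L₀` (`L₀ = Σ_κ 4 sin²(q_κ/2N)` vanishes at `q = 0` and on the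
complex null cone inside every strip).  Here `a′_κ`, `σ′` are the capacitance alias sums over the GOOD aliases `m ≠ 0` only.  At REAL
Brillouin momentum `q ∈ [−π, π]^D` and in the currency of `GAN24/CapacitanceScalarBounds` (`gNormSq`, `blockWt`, `kfine`, `lapR`) these are
the real functions of this file:
* `capDiagOff N q κ = a′_κ(q) = Σ_{m ≠ 0} w_m |s_κ(m)|²/(2 L_m)`, `capBorderOff N q = σ′(q) = Σ_{m ≠ 0} w_m/L_m²` — finite sums of
  NON-NEGATIVE terms, defined on ALL of the zone (`4 ≤ N² L_m` for `m ≠ 0`), `N`-uniformly bounded by leaf P1-L06's `alias_sum_le`;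
* `zeroDiag N q κ = w_0 |s_κ(0)|²/2` (`= wQ0_κ wE0_κ/2`), `aRegR = zeroDiag + L₀·capDiagOff` (`= ã_κ`), `sRegR = w_0 + L₀²·capBorderOff`
  (`= σ̃`).

## What is proved (every `D`, every `N ≥ 1`, EVERY `q ∈ [−π, π]^D` — no `q ≠ 0`, no `1/L₀`; constants explicit, symbolic in `D`, `N`-FREE)
* §1 `capDiagOff_le`: `a′_κ ≤ N^{D+4}·aliasWtConst D/2`; `capBorderOff_le`: `σ′ ≤ N^{D+4}·aliasWtConst D/4`; splitting lemmas
  `capDiag_eq_zero_add_off` / `capBorder_eq_zero_add_off` against Y08s's full sums.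
* §2 `zeroDiag_ge/le`: `(4/π²)^{D+1} N^{D+2}/2 ≤ w_0|s_κ(0)|²/2 ≤ N^{D+2}/2`.
* §3 **`aRegR_ge`**: `(4/π²)^{D+1}·N^{D+2}/2 ≤ ã_κ`; **`aRegR_le`**: `ã_κ ≤ N^{D+2}·(1 + |q|²·aliasWtConst D)/2 ≤ N^{D+2}·aRegUpper D`
  (`aRegUpper D = (1 + Dπ²·aliasWtConst D)/2`); `inv_aRegR_le`; dictionary `aRegR_eq_lapR_mul_capDiag` (`ã_κ = L₀·a_κ` at `q ≠ 0`).
* §4 **`sRegR_ge`**: `(4/π²)^D·N^D ≤ σ̃`; **`sRegR_le`**: `σ̃ ≤ N^D·(1 + |q|⁴·aliasWtConst D/4) ≤ N^D·sRegUpper D`; `inv_sRegR_le`;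
  dictionary `sRegR_eq_lapR_sq_mul_capBorder` (`σ̃ = L₀²·σ` at `q ≠ 0`).
NOT here: `Ω` (part 2); the strip distortion (leaf-18's `StripAliasBounds` / F2 `AliasStripSymbols`); the entry bounds of the closed-form solution;
the pointwise dictionary «concrete complex zero-alias data (`AliasObjects` / leaf-06's `EnlargedCapacitance`) at `ofRealVec q` ↦ these real
functions» (pattern of `GAN24/CapacitanceScalarDictionary`; one `push_cast` lemma per scalar once the concrete `EnlData` is in the tree).

Unit `b2b-balaban-gan24-formalise-leaf-08` (G-an2-4 formalisation swarm, leaf prover 08), 2026-08-20.  Value = banked kernel estimate engine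
toward the K-slot route P1 (alternative road (M2)/(M3) of the strip step L10(ii)), NOT on the (M4) critical path, NOT summit progress.
-/

noncomputable section

open Complex Finset
open scoped BigOperators Real

namespace Summit.QuantumFields.BalabanUV.Beta.GAN24.PinnedScalarBounds

open AliasWeights AliasWeightsSum CapacitanceScalarBounds CapacitanceScalarBoundsBorder
open CapacitanceEndpointBlocks (aliasWtConst_nonneg)
open CapacitanceCancellationDefect (momSq_le_of_abs_le)
open Literature.MathematicalPhysics.QuantumFieldTheory.King1986 (momSq momSq_nonneg)

variable {D : ℕ}

/-! ## §0  Two constants of leaf P1-L06 / the zone: `0 ≤ aliasWtConst D` is `CapacitanceEndpointBlocks.aliasWtConst_nonneg` and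
`|q|² ≤ D·π²` on the zone is `CapacitanceCancellationDefect.momSq_le_of_abs_le` (imported BY NAME). -/

/-! ## §1  The good-alias (`m ≠ 0`) capacitance sums — defined on ALL of the Brillouin zone -/

/-- The GOOD-ALIAS DIAGONAL sum `a′_κ(q) = Σ_{m ≠ 0} w_m·|s_κ(m)|²/(2L_m)` (the `m ≠ 0` part of Y08s's `capDiag`; all `q`, incl. `q = 0`). -/
def capDiagOff (N : ℕ) [NeZero N] (q : Fin D → ℝ) (κ : Fin D) : ℝ :=
  ∑ m ∈ (Finset.univ : Finset (Fin D → ZMod N)).erase 0,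
    blockWt N q m * gNormSq N (kfine N q m κ) / (2 * lapR (kfine N q m))

/-- The GOOD-ALIAS BORDER sum `σ′(q) = Σ_{m ≠ 0} w_m/L_m²` (the `m ≠ 0` part of Y08s's `capBorder`; all `q`, incl. `q = 0`). -/
def capBorderOff (N : ℕ) [NeZero N] (q : Fin D → ℝ) : ℝ :=
  ∑ m ∈ (Finset.univ : Finset (Fin D → ZMod N)).erase 0, blockWt N q m / lapR (kfine N q m) ^ 2

/-- [folklore] `0 ≤ a′_κ(q)`. -/
theorem capDiagOff_nonneg (N : ℕ) [NeZero N] (q : Fin D → ℝ) (κ : Fin D) : 0 ≤ capDiagOff N q κ :=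
  Finset.sum_nonneg fun m _ => capDiag_term_nonneg N q κ m

/-- [folklore] `0 ≤ σ′(q)`. -/
theorem capBorderOff_nonneg (N : ℕ) [NeZero N] (q : Fin D → ℝ) : 0 ≤ capBorderOff N q :=
  Finset.sum_nonneg fun m _ => capBorder_term_nonneg N q m

/-- **`N`-UNIFORM BOUND OF THE GOOD-ALIAS DIAGONAL SUM** on the whole zone: `a′_κ(q) ≤ N^{D+4}·aliasWtConst D/2`
(leaf P1-L06 `alias_sum_le`; no `q ≠ 0` needed). [folklore] -/
theorem capDiagOff_le {N : ℕ} [NeZero N] (hN : 1 ≤ N) {q : Fin D → ℝ} (hq : ∀ i, |q i| ≤ π) (κ : Fin D) :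
    capDiagOff N q κ ≤ (N : ℝ) ^ (D + 4) / 2 * aliasWtConst D := by
  unfold capDiagOff
  calc ∑ m ∈ (Finset.univ : Finset (Fin D → ZMod N)).erase 0,
        blockWt N q m * gNormSq N (kfine N q m κ) / (2 * lapR (kfine N q m))
      ≤ ∑ m ∈ (Finset.univ : Finset (Fin D → ZMod N)).erase 0, (N : ℝ) ^ (D + 4) / 2 * aliasWtTerm N q m :=
        Finset.sum_le_sum fun m hm => capDiag_term_le hN hq κ (Finset.ne_of_mem_erase hm)
    _ = (N : ℝ) ^ (D + 4) / 2 * ∑ m ∈ (Finset.univ : Finset (Fin D → ZMod N)).erase 0, aliasWtTerm N q m := by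
        rw [Finset.mul_sum]
    _ ≤ (N : ℝ) ^ (D + 4) / 2 * aliasWtConst D :=
        mul_le_mul_of_nonneg_left (alias_sum_le N hq) (by positivity)

/-- **`N`-UNIFORM BOUND OF THE GOOD-ALIAS BORDER SUM** on the whole zone: `σ′(q) ≤ N^{D+4}·aliasWtConst D/4`. [folklore] -/
theorem capBorderOff_le {N : ℕ} [NeZero N] (hN : 1 ≤ N) {q : Fin D → ℝ} (hq : ∀ i, |q i| ≤ π) :
    capBorderOff N q ≤ (N : ℝ) ^ (D + 4) / 4 * aliasWtConst D := by
  unfold capBorderOff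
  calc ∑ m ∈ (Finset.univ : Finset (Fin D → ZMod N)).erase 0, blockWt N q m / lapR (kfine N q m) ^ 2
      ≤ ∑ m ∈ (Finset.univ : Finset (Fin D → ZMod N)).erase 0, (N : ℝ) ^ (D + 4) / 4 * aliasWtTerm N q m :=
        Finset.sum_le_sum fun m hm => capBorder_term_le hN hq (Finset.ne_of_mem_erase hm)
    _ = (N : ℝ) ^ (D + 4) / 4 * ∑ m ∈ (Finset.univ : Finset (Fin D → ZMod N)).erase 0, aliasWtTerm N q m := by
        rw [Finset.mul_sum]
    _ ≤ (N : ℝ) ^ (D + 4) / 4 * aliasWtConst D :=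
        mul_le_mul_of_nonneg_left (alias_sum_le N hq) (by positivity)

/-- [folklore] SPLITTING of Y08s's full diagonal sum: `a_κ = (zero-alias term) + a′_κ`. -/
theorem capDiag_eq_zero_add_off (N : ℕ) [NeZero N] (q : Fin D → ℝ) (κ : Fin D) :
    capDiag N q κ = blockWt N q 0 * gNormSq N (kfine N q 0 κ) / (2 * lapR (kfine N q 0)) + capDiagOff N q κ := by
  unfold capDiag capDiagOff
  rw [← Finset.add_sum_erase _ _ (Finset.mem_univ (0 : Fin D → ZMod N))]

/-- [folklore] SPLITTING of Y08s's full border sum: `σ = w_0/L_0² + σ′`. -/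
theorem capBorder_eq_zero_add_off (N : ℕ) [NeZero N] (q : Fin D → ℝ) :
    capBorder N q = blockWt N q 0 / lapR (kfine N q 0) ^ 2 + capBorderOff N q := by
  unfold capBorder capBorderOff
  rw [← Finset.add_sum_erase _ _ (Finset.mem_univ (0 : Fin D → ZMod N))]

/-! ## §2  The zero-alias product `w_0 |s_κ(0)|²/2` (`= wQ0_κ wE0_κ/2`) -/

/-- The ZERO-ALIAS diagonal product `zeroDiag N q κ = w_0·|s_κ(0)|²/2` (`= wQ0_κ wE0_κ/2 = S(0)χ̂(0)·s_κ(0)s♭_κ(0)/2` at real `q`). -/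
def zeroDiag (N : ℕ) (q : Fin D → ℝ) (κ : Fin D) : ℝ := blockWt N q 0 * gNormSq N (kfine N q 0 κ) / 2

/-- [folklore] **LOWER BOUND** `(4/π²)^{D+1}·N^{D+2}/2 ≤ w_0|s_κ(0)|²/2` on the whole zone (Jordan, Y08s `pow_le_blockWt_zero` and
`sq_le_gNormSq_zero` by name). -/
theorem zeroDiag_ge {N : ℕ} (hN : 1 ≤ N) {q : Fin D → ℝ} (hq : ∀ i, |q i| ≤ π) (κ : Fin D) :
    (4 / π ^ 2) ^ (D + 1) * (N : ℝ) ^ (D + 2) / 2 ≤ zeroDiag N q κ := by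
  have hw := pow_le_blockWt_zero hN hq
  have hg : 4 / π ^ 2 * (N : ℝ) ^ 2 ≤ gNormSq N (kfine N q 0 κ) := by
    rw [kfine_zero]; exact sq_le_gNormSq_zero hN (hq κ)
  have h := mul_le_mul hw hg (by positivity) (blockWt_nonneg _ _ _)
  unfold zeroDiag
  calc (4 / π ^ 2) ^ (D + 1) * (N : ℝ) ^ (D + 2) / 2
      = (4 / π ^ 2) ^ D * (N : ℝ) ^ D * (4 / π ^ 2 * (N : ℝ) ^ 2) / 2 := by ring
    _ ≤ blockWt N q 0 * gNormSq N (kfine N q 0 κ) / 2 := by linarith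

/-- [folklore] **UPPER BOUND** `w_0|s_κ(0)|²/2 ≤ N^{D+2}/2`. -/
theorem zeroDiag_le {N : ℕ} (hN : 1 ≤ N) (q : Fin D → ℝ) (κ : Fin D) : zeroDiag N q κ ≤ (N : ℝ) ^ (D + 2) / 2 := by
  have h := mul_le_mul (blockWt_le_pow hN q 0) (gNormSq_le_sq N (kfine N q 0 κ)) (gNormSq_nonneg _ _)
    (pow_nonneg (Nat.cast_nonneg N) D)
  unfold zeroDiag
  calc blockWt N q 0 * gNormSq N (kfine N q 0 κ) / 2 ≤ (N : ℝ) ^ D * (N : ℝ) ^ 2 / 2 := by linarith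
    _ = (N : ℝ) ^ (D + 2) / 2 := by ring

/-- [folklore] `0 < zeroDiag N q κ` (`N ≥ 1`). -/
theorem zeroDiag_pos {N : ℕ} (hN : 1 ≤ N) {q : Fin D → ℝ} (hq : ∀ i, |q i| ≤ π) (κ : Fin D) : 0 < zeroDiag N q κ := by
  have hN0 : (0 : ℝ) < N := by exact_mod_cast hN
  exact lt_of_lt_of_le (by positivity) (zeroDiag_ge hN hq κ)

/-! ## §3  The regularised diagonal scalar `ã_κ = w_0|s_κ(0)|²/2 + L₀·a′_κ` -/

/-- The REGULARISED DIAGONAL scalar `ã_κ(q) = w_0|s_κ(0)|²/2 + L₀·a′_κ(q)` (`aReg` of `CapacitanceClosedFormEnlarged` at real `q`;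
`= L₀·a_κ` when `q ≠ 0`). -/
def aRegR (N : ℕ) [NeZero N] (q : Fin D → ℝ) (κ : Fin D) : ℝ := zeroDiag N q κ + lapR (kfine N q 0) * capDiagOff N q κ

/-- The `N`-free UPPER constant `aRegUpper D = (1 + D·π²·aliasWtConst D)/2` of `ã_κ/N^{D+2}`. -/
def aRegUpper (D : ℕ) : ℝ := (1 + D * π ^ 2 * aliasWtConst D) / 2

/-- [folklore] `0 < aRegUpper D`. -/
theorem aRegUpper_pos (D : ℕ) : 0 < aRegUpper D := by
  unfold aRegUpper
  have := aliasWtConst_nonneg D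
  positivity

/-- [folklore] The good-alias correction is non-negative: `0 ≤ L₀·a′_κ`. -/
theorem lapR_mul_capDiagOff_nonneg (N : ℕ) [NeZero N] (q : Fin D → ℝ) (κ : Fin D) :
    0 ≤ lapR (kfine N q 0) * capDiagOff N q κ :=
  mul_nonneg (lapR_nonneg _) (capDiagOff_nonneg N q κ)

/-- [folklore] The good-alias correction is `N`-uniformly small in natural units: `L₀·a′_κ ≤ |q|²·aliasWtConst D/2 · N^{D+2}`
(`N²L₀ ≤ |q|²`, leaf P1-L07 by name, times `capDiagOff_le`). -/
theorem lapR_mul_capDiagOff_le {N : ℕ} [NeZero N] (hN : 1 ≤ N) {q : Fin D → ℝ} (hq : ∀ i, |q i| ≤ π) (κ : Fin D) :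
    lapR (kfine N q 0) * capDiagOff N q κ ≤ momSq q * aliasWtConst D / 2 * (N : ℝ) ^ (D + 2) := by
  have hN0 : (0 : ℝ) < N := by exact_mod_cast hN
  have hL : lapR (kfine N q 0) ≤ momSq q / (N : ℝ) ^ 2 := by
    rw [le_div_iff₀ (by positivity)]
    have := sq_mul_lapR_zero_le hN q
    linarith
  calc lapR (kfine N q 0) * capDiagOff N q κ ≤ (momSq q / (N : ℝ) ^ 2) * ((N : ℝ) ^ (D + 4) / 2 * aliasWtConst D) :=
        mul_le_mul hL (capDiagOff_le hN hq κ) (capDiagOff_nonneg N q κ) (div_nonneg (momSq_nonneg q) (by positivity))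
    _ = momSq q * aliasWtConst D / 2 * (N : ℝ) ^ (D + 2) := by
        field_simp
        ring

/-- **LOWER BOUND FOR `ã_κ` ON THE WHOLE ZONE** (`q = 0` included; zero alias alone): `(4/π²)^{D+1}·N^{D+2}/2 ≤ ã_κ(q)`. [folklore] -/
theorem aRegR_ge {N : ℕ} [NeZero N] (hN : 1 ≤ N) {q : Fin D → ℝ} (hq : ∀ i, |q i| ≤ π) (κ : Fin D) :
    (4 / π ^ 2) ^ (D + 1) * (N : ℝ) ^ (D + 2) / 2 ≤ aRegR N q κ := by
  unfold aRegR
  linarith [zeroDiag_ge hN hq κ, lapR_mul_capDiagOff_nonneg N q κ]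

/-- **UPPER BOUND FOR `ã_κ` ON THE WHOLE ZONE** (with the `|q|²` dependence displayed): `ã_κ(q) ≤ N^{D+2}·(1 + |q|²·aliasWtConst D)/2`.
[folklore] -/
theorem aRegR_le {N : ℕ} [NeZero N] (hN : 1 ≤ N) {q : Fin D → ℝ} (hq : ∀ i, |q i| ≤ π) (κ : Fin D) :
    aRegR N q κ ≤ (N : ℝ) ^ (D + 2) * ((1 + momSq q * aliasWtConst D) / 2) := by
  unfold aRegR
  have h1 := zeroDiag_le hN q κ
  have h2 := lapR_mul_capDiagOff_le hN hq κ
  linarith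

/-- **`q`-UNIFORM UPPER BOUND FOR `ã_κ`**: `ã_κ(q) ≤ N^{D+2}·aRegUpper D` on the whole zone. [folklore] -/
theorem aRegR_le' {N : ℕ} [NeZero N] (hN : 1 ≤ N) {q : Fin D → ℝ} (hq : ∀ i, |q i| ≤ π) (κ : Fin D) :
    aRegR N q κ ≤ (N : ℝ) ^ (D + 2) * aRegUpper D := by
  refine (aRegR_le hN hq κ).trans (mul_le_mul_of_nonneg_left ?_ (pow_nonneg (Nat.cast_nonneg N) _))
  unfold aRegUpper
  have hm := momSq_le_of_abs_le hq
  have ha := aliasWtConst_nonneg D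
  have : momSq q * aliasWtConst D ≤ D * π ^ 2 * aliasWtConst D := mul_le_mul_of_nonneg_right hm ha
  linarith

/-- [folklore] `0 < ã_κ(q)` on the whole zone, every `N ≥ 1`. -/
theorem aRegR_pos {N : ℕ} [NeZero N] (hN : 1 ≤ N) {q : Fin D → ℝ} (hq : ∀ i, |q i| ≤ π) (κ : Fin D) : 0 < aRegR N q κ := by
  have hN0 : (0 : ℝ) < N := by exact_mod_cast hN
  exact lt_of_lt_of_le (by positivity) (aRegR_ge hN hq κ)

/-- [folklore] INVERSE FORM: `ã_κ(q)⁻¹ ≤ 2/((4/π²)^{D+1}·N^{D+2})` on the whole zone. -/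
theorem inv_aRegR_le {N : ℕ} [NeZero N] (hN : 1 ≤ N) {q : Fin D → ℝ} (hq : ∀ i, |q i| ≤ π) (κ : Fin D) :
    (aRegR N q κ)⁻¹ ≤ 2 / ((4 / π ^ 2) ^ (D + 1) * (N : ℝ) ^ (D + 2)) := by
  have hN0 : (0 : ℝ) < N := by exact_mod_cast hN
  have hlow : 0 < (4 / π ^ 2) ^ (D + 1) * (N : ℝ) ^ (D + 2) / 2 := by positivity
  calc (aRegR N q κ)⁻¹ ≤ ((4 / π ^ 2) ^ (D + 1) * (N : ℝ) ^ (D + 2) / 2)⁻¹ := inv_anti₀ hlow (aRegR_ge hN hq κ)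
    _ = 2 / ((4 / π ^ 2) ^ (D + 1) * (N : ℝ) ^ (D + 2)) := by rw [inv_div]

/-- [folklore] DICTIONARY WITH Y08s AT `q ≠ 0`: `ã_κ(q) = L₀·a_κ(q)` (`capDiag` carries the `m = 0` pole `1/L₀`; `ã_κ` does not). -/
theorem aRegR_eq_lapR_mul_capDiag {N : ℕ} [NeZero N] (hN : 1 ≤ N) {q : Fin D → ℝ} (hq : ∀ i, |q i| ≤ π) (hq0 : q ≠ 0)
    (κ : Fin D) : aRegR N q κ = lapR (kfine N q 0) * capDiag N q κ := by
  have hL := (lapR_zero_pos hN hq hq0).ne'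
  rw [capDiag_eq_zero_add_off, mul_add]
  unfold aRegR zeroDiag
  congr 1
  rw [← mul_div_assoc, mul_comm (lapR (kfine N q 0)), mul_div_mul_right _ _ hL]

/-! ## §4  The regularised border scalar `σ̃ = w_0 + L₀²·σ′` -/

/-- The REGULARISED BORDER scalar `σ̃(q) = w_0 + L₀²·σ′(q)` (`sReg` of `CapacitanceClosedFormEnlarged` at real `q`; `= L₀²·σ` when
`q ≠ 0`; `w_0 = wM0 wG0 = |S(0)|²/N^D`). -/
def sRegR (N : ℕ) [NeZero N] (q : Fin D → ℝ) : ℝ := blockWt N q 0 + lapR (kfine N q 0) ^ 2 * capBorderOff N q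

/-- The `N`-free UPPER constant `sRegUpper D = 1 + (D·π²)²·aliasWtConst D/4` of `σ̃/N^D`. -/
def sRegUpper (D : ℕ) : ℝ := 1 + (D * π ^ 2) ^ 2 * aliasWtConst D / 4

/-- [folklore] The good-alias correction is non-negative: `0 ≤ L₀²·σ′`. -/
theorem lapR_sq_mul_capBorderOff_nonneg (N : ℕ) [NeZero N] (q : Fin D → ℝ) :
    0 ≤ lapR (kfine N q 0) ^ 2 * capBorderOff N q :=
  mul_nonneg (sq_nonneg _) (capBorderOff_nonneg N q)

/-- [folklore] `L₀²·σ′ ≤ |q|⁴·aliasWtConst D/4 · N^D` (`N²L₀ ≤ |q|²` squared, times `capBorderOff_le`). -/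
theorem lapR_sq_mul_capBorderOff_le {N : ℕ} [NeZero N] (hN : 1 ≤ N) {q : Fin D → ℝ} (hq : ∀ i, |q i| ≤ π) :
    lapR (kfine N q 0) ^ 2 * capBorderOff N q ≤ momSq q ^ 2 * aliasWtConst D / 4 * (N : ℝ) ^ D := by
  have hN0 : (0 : ℝ) < N := by exact_mod_cast hN
  have hL : lapR (kfine N q 0) ≤ momSq q / (N : ℝ) ^ 2 := by
    rw [le_div_iff₀ (by positivity)]
    have := sq_mul_lapR_zero_le hN q
    linarith
  have hL2 : lapR (kfine N q 0) ^ 2 ≤ (momSq q / (N : ℝ) ^ 2) ^ 2 := pow_le_pow_left₀ (lapR_nonneg _) hL 2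
  calc lapR (kfine N q 0) ^ 2 * capBorderOff N q ≤ (momSq q / (N : ℝ) ^ 2) ^ 2 * ((N : ℝ) ^ (D + 4) / 4 * aliasWtConst D) :=
        mul_le_mul hL2 (capBorderOff_le hN hq) (capBorderOff_nonneg N q) (sq_nonneg _)
    _ = momSq q ^ 2 * aliasWtConst D / 4 * (N : ℝ) ^ D := by
        field_simp
        ring

/-- **LOWER BOUND FOR `σ̃` ON THE WHOLE ZONE** (`q = 0` included; zero alias alone): `(4/π²)^D·N^D ≤ σ̃(q)`. [folklore] -/
theorem sRegR_ge {N : ℕ} [NeZero N] (hN : 1 ≤ N) {q : Fin D → ℝ} (hq : ∀ i, |q i| ≤ π) :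
    (4 / π ^ 2) ^ D * (N : ℝ) ^ D ≤ sRegR N q := by
  unfold sRegR
  linarith [pow_le_blockWt_zero hN hq, lapR_sq_mul_capBorderOff_nonneg N q]

/-- **UPPER BOUND FOR `σ̃` ON THE WHOLE ZONE** (with the `|q|⁴` dependence displayed): `σ̃(q) ≤ N^D·(1 + |q|⁴·aliasWtConst D/4)`.
[folklore] -/
theorem sRegR_le {N : ℕ} [NeZero N] (hN : 1 ≤ N) {q : Fin D → ℝ} (hq : ∀ i, |q i| ≤ π) :
    sRegR N q ≤ (N : ℝ) ^ D * (1 + momSq q ^ 2 * aliasWtConst D / 4) := by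
  unfold sRegR
  have h1 := blockWt_le_pow hN q 0
  have h2 := lapR_sq_mul_capBorderOff_le hN hq
  linarith

/-- **`q`-UNIFORM UPPER BOUND FOR `σ̃`**: `σ̃(q) ≤ N^D·sRegUpper D` on the whole zone. [folklore] -/
theorem sRegR_le' {N : ℕ} [NeZero N] (hN : 1 ≤ N) {q : Fin D → ℝ} (hq : ∀ i, |q i| ≤ π) :
    sRegR N q ≤ (N : ℝ) ^ D * sRegUpper D := by
  refine (sRegR_le hN hq).trans (mul_le_mul_of_nonneg_left ?_ (pow_nonneg (Nat.cast_nonneg N) _))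
  unfold sRegUpper
  have hm := momSq_le_of_abs_le hq
  have hm2 : momSq q ^ 2 ≤ (D * π ^ 2) ^ 2 := pow_le_pow_left₀ (momSq_nonneg q) hm 2
  have ha := aliasWtConst_nonneg D
  have : momSq q ^ 2 * aliasWtConst D ≤ (D * π ^ 2) ^ 2 * aliasWtConst D := mul_le_mul_of_nonneg_right hm2 ha
  linarith

/-- [folklore] `0 < σ̃(q)` on the whole zone, every `N ≥ 1`. -/
theorem sRegR_pos {N : ℕ} [NeZero N] (hN : 1 ≤ N) {q : Fin D → ℝ} (hq : ∀ i, |q i| ≤ π) : 0 < sRegR N q := by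
  have hN0 : (0 : ℝ) < N := by exact_mod_cast hN
  exact lt_of_lt_of_le (by positivity) (sRegR_ge hN hq)

/-- [folklore] INVERSE FORM: `σ̃(q)⁻¹ ≤ 1/((4/π²)^D·N^D)` on the whole zone. -/
theorem inv_sRegR_le {N : ℕ} [NeZero N] (hN : 1 ≤ N) {q : Fin D → ℝ} (hq : ∀ i, |q i| ≤ π) :
    (sRegR N q)⁻¹ ≤ ((4 / π ^ 2) ^ D * (N : ℝ) ^ D)⁻¹ := by
  have hN0 : (0 : ℝ) < N := by exact_mod_cast hN
  exact inv_anti₀ (by positivity) (sRegR_ge hN hq)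

/-- [folklore] DICTIONARY WITH Y08s AT `q ≠ 0`: `σ̃(q) = L₀²·σ(q)`. -/
theorem sRegR_eq_lapR_sq_mul_capBorder {N : ℕ} [NeZero N] (hN : 1 ≤ N) {q : Fin D → ℝ} (hq : ∀ i, |q i| ≤ π)
    (hq0 : q ≠ 0) : sRegR N q = lapR (kfine N q 0) ^ 2 * capBorder N q := by
  have hL := (lapR_zero_pos hN hq hq0).ne'
  rw [capBorder_eq_zero_add_off, mul_add]
  unfold sRegR
  congr 1
  rw [← mul_div_assoc, mul_div_cancel_left₀ _ (pow_ne_zero 2 hL)]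

end Summit.QuantumFields.BalabanUV.Beta.GAN24.PinnedScalarBounds

end
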